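import Summits.ResolutionOfSingularities.ResolutionOfSingularities.Theorems.TeissierJungTeissierResolveBranchAlgebra
import Summits.ResolutionOfSingularities.ResolutionOfSingularities.Theorems.SectionAscentFibrewiseClosedPointsClosedPointsSuffice
import Summits.ResolutionOfSingularities.ResolutionOfSingularities.Theses.TeissierJung
import Literature.AlgebraicGeometry.Resolution.AdicQuotient
import Literature.AlgebraicGeometry.Resolution.SurfaceResolutionReduction
import Literature.AlgebraicGeometry.Resolution.NormalAscentCompletion
import Literature.AlgebraicGeometry.Resolution.TeissierPresentation
import Mathlib.RingTheory.Localization.Finiteness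
import Mathlib.RingTheory.LocalRing.RingHom.Basic
import Mathlib.RingTheory.DedekindDomain.Instances
import HarnessLib

/-!
# `TeissierResolve` — support lemmas II: regular analytic branches ⇒ the normalisation resolves

Support theorems for the crux `stmt-ResolutionOfSingularities-17086`
(`Summit.ResolutionOfSingularities.ResolutionOfSingularities.Theses.TeissierJung.TeissierResolve`:
every Teissier-presented `X'` — the predicate `TF` = `TeissierPresented` — has a resolution).
`TF` constrains `X'` only through the analytic branches `𝒪̂_{X',x} ⧸ P` at closed points; this
file settles the sub-class in which all branches are REGULAR local rings (the `g = 0`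
presentations `k⟦x₁,…,x_d⟧`), the piece named accessible by the crux's disprover
(`Cruxes/TeissierResolve/Disproof.lean` §C): there the normalisation is already a resolution.

* `isRegularLocalRing_atPrime_of_branches_regular` — GLOBAL ALGEBRA: `A` a Noetherian domain,
  `C₀ ⊇ A` a domain, module-finite and birational over `A`, analytically irreducible at maximal
  ideals; if every branch `(A_𝔭)^ ⧸ P` at a maximal `𝔭` is regular then `(C₀)_Q` is regular for
  every maximal `Q` over `𝔭` (localise; apply `isRegularLocalRing_localization_of_branches_regular`
  of `TeissierJungTeissierResolveBranchAlgebra.lean` to `A_𝔭 ⊆ S⁻¹C₀`).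
* `isRegular_normalization_of_branches_regular` — SCHEMES: for `X` integral of finite type over a
  field, if every analytic branch at every closed point is regular then `X^ν` is regular (over an
  affine `U = Spec A ∋ x`, `X^ν ×_X U = Spec C₀`, `C₀` the integral closure of `A` in `K(X)`:
  finite by E. Noether, birational, analytically irreducible at maximal ideals by Zariski's
  analytic normality, `isDomain_and_isIntegrallyClosed_adicCompletion_localization_atPrime`;
  closed points suffice since the regular locus is open).
* `hasResolution_of_branches_regular` — hence `Scheme.HasResolution X`
  (`Scheme.HasResolution.of_normalization`).
* `teissierPresented_hasResolution_of_branches_regular`, `teissierResolve_of_branches_regular` —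
  the sub-case of the crux.

Sources: Zariski, Ann. Inst. Fourier 2 (1950); Zariski–Samuel II, VIII §13; Nagata, *Local Rings*
(37.5)–(37.8); Stacks 0C23, 07N9. Everything here is [folklore]; no definitions, no named facts.
-/

noncomputable section

set_option linter.dupNamespace false -- mandated namespace of this single-conjunct summit

open IsLocalRing
open Literature.AlgebraicGeometry.Resolution

namespace Summit.ResolutionOfSingularities.ResolutionOfSingularities.Theorems.TeissierResolve.RegularBranches

universe u

/-! ## Global form: a finite birational extension `C₀` of a Noetherian domain `A` -/

section Global

variable {A : Type u} [CommRing A] [IsDomain A] [IsNoetherianRing A]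
variable {C₀ : Type u} [CommRing C₀] [IsDomain C₀] [Algebra A C₀] [Module.Finite A C₀]

/-- Transport of "the completed local ring is a domain" along a ring isomorphism of local rings
(`adicCompletionCongr`). [folklore] -/
theorem isDomain_adicCompletion_of_ringEquiv {S S₂ : Type u} [CommRing S] [CommRing S₂]
    [IsLocalRing S] [IsLocalRing S₂] (e : S ≃+* S₂)
    [h : IsDomain (AdicCompletion (maximalIdeal S₂) S₂)] :
    IsDomain (AdicCompletion (maximalIdeal S) S) :=
  MulEquiv.isDomain _ (adicCompletionCongr (maximalIdeal S) (maximalIdeal S₂) e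
    (by rw [RingEquiv.toRingHom_eq_coe]; exact IsLocalRing.map_ringEquiv_maximalIdeal e)).toMulEquiv

/-- Transport of "every analytic branch is regular" along a ring isomorphism of local rings.
[folklore] -/
theorem branches_regular_of_ringEquiv {S S₂ : Type u} [CommRing S] [CommRing S₂]
    [IsLocalRing S] [IsLocalRing S₂] (e : S ≃+* S₂)
    (h : ∀ P ∈ minimalPrimes (AdicCompletion (maximalIdeal S) S),
      IsRegularLocalRing (AdicCompletion (maximalIdeal S) S ⧸ P)) :
    ∀ P ∈ minimalPrimes (AdicCompletion (maximalIdeal S₂) S₂),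
      IsRegularLocalRing (AdicCompletion (maximalIdeal S₂) S₂ ⧸ P) := by
  set ê := adicCompletionCongr (maximalIdeal S) (maximalIdeal S₂) e
    (by rw [RingEquiv.toRingHom_eq_coe]; exact IsLocalRing.map_ringEquiv_maximalIdeal e)
  set f : AdicCompletion (maximalIdeal S) S →+* AdicCompletion (maximalIdeal S₂) S₂ :=
    (ê : AdicCompletion (maximalIdeal S) S →+* AdicCompletion (maximalIdeal S₂) S₂)
  have hfs : Function.Surjective f := ê.surjective
  have hfi : Function.Injective f := ê.injective
  intro P hP
  have hP' : P.comap f ∈ minimalPrimes (AdicCompletion (maximalIdeal S) S) := by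
    have key := Ideal.comap_minimalPrimes_eq_of_surjective hfs ⊥
    rw [Ideal.comap_bot_of_injective f hfi] at key
    change _ ∈ Ideal.minimalPrimes ⊥
    rw [key]
    exact ⟨P, hP, rfl⟩
  haveI := h _ hP'
  exact IsRegularLocalRing.of_ringEquiv
    (Ideal.quotientEquiv (P.comap f) P ê (Ideal.map_comap_of_surjective f hfs P).symm)

/-- **Regular analytic branches below force regular local rings above — global form.** Let `A`
be a Noetherian domain and `C₀ ⊇ A` a domain, module-finite and birational over `A` (e.g. the
normalisation of a domain of finite type over a field), whose local rings at maximal ideals have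
domains as completions. Let `𝔭 ⊆ A` be a maximal ideal such that every analytic branch
`(A_𝔭)^ ⧸ P` (`P` minimal) is a regular local ring. Then `(C₀)_Q` is a regular local ring for
every maximal ideal `Q` of `C₀` over `𝔭` (localise at `𝔭` and apply
`isRegularLocalRing_localization_of_branches_regular` to `A_𝔭 ⊆ C₀ ⊗_A A_𝔭`). [folklore] -/
theorem isRegularLocalRing_atPrime_of_branches_regular
    (hinj : Function.Injective (algebraMap A C₀))
    (hbir : ∀ c : C₀, ∃ s : A, s ≠ 0 ∧ ∃ a : A, s • c = algebraMap A C₀ a)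
    (hdom : ∀ (Q : Ideal C₀) [Q.IsMaximal],
      IsDomain (AdicCompletion (maximalIdeal (Localization.AtPrime Q)) (Localization.AtPrime Q)))
    (𝔭 : Ideal A) [𝔭.IsMaximal]
    (hreg : ∀ P ∈ minimalPrimes (AdicCompletion (maximalIdeal (Localization.AtPrime 𝔭))
        (Localization.AtPrime 𝔭)),
      IsRegularLocalRing (AdicCompletion (maximalIdeal (Localization.AtPrime 𝔭))
        (Localization.AtPrime 𝔭) ⧸ P))
    (Q : Ideal C₀) [Q.IsMaximal] (hQ : Q.comap (algebraMap A C₀) = 𝔭) :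
    IsRegularLocalRing (Localization.AtPrime Q) := by
  classical
  -- the localisations `R = A_𝔭 ⊆ C = S⁻¹ C₀`, `S` the image of `A ∖ 𝔭`
  set R := Localization.AtPrime 𝔭 with hR
  set S := Algebra.algebraMapSubmonoid C₀ 𝔭.primeCompl with hSdef
  set C := Localization S with hC
  haveI : FaithfulSMul A C₀ := (faithfulSMul_iff_algebraMap_injective A C₀).mpr hinj
  have hS : S ≤ nonZeroDivisors C₀ :=
    algebraMapSubmonoid_le_nonZeroDivisors_of_faithfulSMul C₀ 𝔭.primeCompl_le_nonZeroDivisors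
  haveI : IsDomain C := IsLocalization.isDomain_localization hS
  haveI : IsLocalization (𝔭.primeCompl.map (algebraMap A C₀)) C := Localization.isLocalization
  have hmap : algebraMap R C =
      IsLocalization.map (T := S) C (algebraMap A C₀) (Submonoid.le_comap_map _) := by
    apply IsLocalization.ringHom_ext 𝔭.primeCompl
    simp only [IsLocalization.map_comp, ← IsScalarTower.algebraMap_eq]
  have hinjR : Function.Injective (algebraMap R C) := by
    rw [hmap]
    exact IsLocalization.map_injective_of_injective (M := 𝔭.primeCompl) (S := R) (Q := C) hinj
  have hinjAR : Function.Injective (algebraMap A R) :=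
    IsLocalization.injective R 𝔭.primeCompl_le_nonZeroDivisors
  -- birationality of `C` over `R`
  have hbirC : ∀ c : C, ∃ s : R, s ≠ 0 ∧ ∃ a : R, s • c = algebraMap R C a := by
    intro c
    obtain ⟨c₀, t', rfl⟩ := IsLocalization.exists_mk'_eq S c
    obtain ⟨t, ht, htt'⟩ := (Submonoid.mem_map).mp t'.2
    obtain ⟨u, hu, a, hua⟩ := hbir c₀
    refine ⟨algebraMap A R u, fun h0 => hu (hinjAR (by rw [h0, map_zero])),
      IsLocalization.mk' R a ⟨t, ht⟩, ?_⟩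
    rw [Algebra.smul_def, ← IsScalarTower.algebraMap_apply, IsScalarTower.algebraMap_apply A C₀ C,
      IsLocalization.mul_mk'_eq_mk'_of_mul, ← Algebra.smul_def, hua, hmap, IsLocalization.map_mk']
    congr 1
    exact Subtype.ext htt'.symm
  -- analytic irreducibility at the maximal ideals of `C`
  have hdomC : ∀ n : MaximalSpectrum C, IsDomain
      (AdicCompletion (maximalIdeal (Localization.AtPrime n.asIdeal))
        (Localization.AtPrime n.asIdeal)) := by
    intro n
    haveI := n.isMaximal
    set Q' := n.asIdeal.comap (algebraMap C₀ C) with hQ'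
    -- `Q'` lies over `𝔭`, hence is maximal
    have hQ'A : Q'.comap (algebraMap A C₀) = 𝔭 := by
      have e1 : Q'.comap (algebraMap A C₀) =
          (n.asIdeal.comap (algebraMap R C)).comap (algebraMap A R) := by
        rw [hQ', Ideal.comap_comap, Ideal.comap_comap, ← IsScalarTower.algebraMap_eq,
          ← IsScalarTower.algebraMap_eq]
      rw [e1, under_eq_maximalIdeal_of_isMaximal R C n.asIdeal]
      exact Localization.AtPrime.under_maximalIdeal
    haveI : Q'.IsMaximal :=
      Ideal.isMaximal_of_isIntegral_of_isMaximal_comap (R := A) Q' (by rw [hQ'A]; infer_instance)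
    haveI := hdom Q'
    haveI : IsLocalization.AtPrime (Localization.AtPrime n.asIdeal) Q' :=
      IsLocalization.isLocalization_atPrime_localization_atPrime S n.asIdeal
    exact isDomain_adicCompletion_of_ringEquiv
      (IsLocalization.algEquiv Q'.primeCompl (Localization.AtPrime n.asIdeal)
        (Localization.AtPrime Q')).toRingEquiv
  -- the maximal ideal `𝔫 = Q C` of `C` over `Q`
  have hdisj : Disjoint (S : Set C₀) Q := by
    rw [Set.disjoint_left]
    rintro _ ⟨t, ht, rfl⟩ htQ
    exact ht (hQ ▸ Ideal.mem_comap.mpr htQ : t ∈ 𝔭)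
  set 𝔫 := Q.map (algebraMap C₀ C) with h𝔫
  haveI h𝔫p : 𝔫.IsPrime := IsLocalization.isPrime_of_isPrime_disjoint S C Q inferInstance hdisj
  have h𝔫Q : 𝔫.comap (algebraMap C₀ C) = Q := IsLocalization.under_map_of_isPrime_disjoint S C inferInstance hdisj
  have h𝔫max : 𝔫.IsMaximal := by
    refine isMaximal_of_isPrime_of_map_maximalIdeal_le R C 𝔫 ?_
    have e1 : (maximalIdeal R).map (algebraMap R C) = 𝔭.map (algebraMap A C) := by
      rw [← Localization.AtPrime.map_eq_maximalIdeal, Ideal.map_map, ← IsScalarTower.algebraMap_eq]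
    rw [e1, IsScalarTower.algebraMap_eq A C₀ C, ← Ideal.map_map, h𝔫]
    exact Ideal.map_mono (Ideal.map_le_iff_le_comap.mpr hQ.ge)
  -- the local theorem at `𝔫`, then `C_𝔫 ≅ (C₀)_Q`
  have hcore := isRegularLocalRing_localization_of_branches_regular (R := R) (C := C) hinjR hbirC
    hdomC hreg ⟨𝔫, h𝔫max⟩
  haveI : IsLocalization.AtPrime (Localization.AtPrime 𝔫) Q := by
    have h1 : IsLocalization.AtPrime (Localization.AtPrime 𝔫) (𝔫.comap (algebraMap C₀ C)) :=
      IsLocalization.isLocalization_atPrime_localization_atPrime S 𝔫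
    refine @IsLocalization.of_le C₀ _ (𝔫.comap (algebraMap C₀ C)).primeCompl _ _ _ h1
      Q.primeCompl (fun x hx => ?_) (fun r hr => ?_)
    · change x ∉ Q
      rw [← h𝔫Q]
      exact hx
    · exact @IsLocalization.map_units C₀ _ (𝔫.comap (algebraMap C₀ C)).primeCompl _ _ _ h1
        ⟨r, show r ∉ _ by rw [h𝔫Q]; exact hr⟩
  haveI := hcore
  exact IsRegularLocalRing.of_ringEquiv
    (IsLocalization.algEquiv Q.primeCompl (Localization.AtPrime 𝔫) (Localization.AtPrime Q)).toRingEquiv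

end Global

/-! ## Schemes: regular analytic branches ⇒ the normalisation is a resolution -/

section Schemes

open CategoryTheory AlgebraicGeometry TopologicalSpace

/-- **If every analytic branch at every closed point of an integral scheme `X` of finite type
over a field is a regular local ring, then the normalisation `X^ν` is regular.** At a closed
point `y` of `X^ν` over the closed point `x ∈ X`, choose an affine `U = Spec A ∋ x`; then
`X^ν ×_X U = Spec C₀` with `C₀` the integral closure of `A` in `K(X)` (finite over `A` by
E. Noether, birational, with analytically irreducible local rings by Zariski's analytic
normality of normal varieties, `isDomain_and_isIntegrallyClosed_adicCompletion_localization_atPrime`),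
and `𝒪_{X^ν,y} = (C₀)_Q` for a maximal `Q` over the maximal ideal of `x`; apply
`isRegularLocalRing_atPrime_of_branches_regular`. Closed points suffice because the regular
locus of a scheme of finite type over a field is open. [folklore] -/
theorem isRegular_normalization_of_branches_regular {k : Type u} [Field k] (X : Scheme.{u})
    [IsIntegral X] (f : X ⟶ Spec (.of k)) [LocallyOfFiniteType f] [QuasiCompact f]
    (h : ∀ x : X, IsClosed ({x} : Set X) →
      ∀ P ∈ minimalPrimes (AdicCompletion (maximalIdeal (X.presheaf.stalk x)) (X.presheaf.stalk x)),
        IsRegularLocalRing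
          (AdicCompletion (maximalIdeal (X.presheaf.stalk x)) (X.presheaf.stalk x) ⧸ P)) :
    Scheme.IsRegular (normalization X) := by
  classical
  haveI hfin : IsFinite (normalizationι X) :=
    isFinite_normalizationι X NoetherFiniteIntegralClosure_holds f
  haveI : CompactSpace X := QuasiCompact.compactSpace_of_compactSpace f
  haveI : CompactSpace (normalization X) :=
    QuasiCompact.compactSpace_of_compactSpace (normalizationι X)
  refine SectionAscent.ClosedPointsSuffice.isRegular_of_isClosed_singleton (normalizationι X ≫ f)
    fun y hy => ?_
  -- the closed point `x = π y` and an affine neighbourhood `U = Spec A`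
  set π := normalizationι X with hπ
  have hx : IsClosed ({π y} : Set X) := by
    simpa using π.isClosedMap _ hy
  obtain ⟨_, ⟨U, hU, rfl⟩, hxU, -⟩ := X.isBasis_affineOpens.exists_subset_of_mem_open
    (Set.mem_univ (π y)) isOpen_univ
  haveI : Nonempty U := ⟨⟨_, hxU⟩⟩
  have hV : IsAffineOpen (π ⁻¹ᵁ U) := hU.preimage π
  have hyV : y ∈ π ⁻¹ᵁ U := hxU
  -- the stalk at `y` is the localisation of `B = Γ(X^ν, π⁻¹ U)` at the maximal ideal `𝔔` of `y`
  letI := (normalization X).presheaf.algebra_section_stalk (⟨y, hyV⟩ : ↥(π ⁻¹ᵁ U))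
  haveI := hV.isLocalization_stalk ⟨y, hyV⟩
  set 𝔔 := hV.primeIdealOf ⟨y, hyV⟩ with h𝔔
  haveI h𝔔max : 𝔔.asIdeal.IsMaximal := hV.primeIdealOf_isMaximal_of_isClosed ⟨y, hyV⟩ hy
  suffices hreg : IsRegularLocalRing (Localization.AtPrime 𝔔.asIdeal) by
    exact IsRegularLocalRing.of_ringEquiv (IsLocalization.algEquiv 𝔔.asIdeal.primeCompl
      (Localization.AtPrime 𝔔.asIdeal)
      ((normalization X).presheaf.stalk ((⟨y, hyV⟩ : ↥(π ⁻¹ᵁ U)) : ↥(normalization X)))).toRingEquiv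
  -- `A = Γ(X, U)`, a finitely generated `k`-domain with fraction field `K(X)`
  set A := Γ(X, U) with hA
  let φ : k →+* A := (f.appLE ⊤ U le_top).hom.comp (Scheme.ΓSpecIso (.of k)).inv.hom
  have hφ : φ.FiniteType := by
    refine RingHom.FiniteType.comp ?_ (RingHom.FiniteType.of_surjective _
      (Scheme.ΓSpecIso (.of k)).symm.commRingCatIsoToRingEquiv.surjective)
    exact HasRingHomProperty.appLE @LocallyOfFiniteType f ‹_› ⟨⊤, isAffineOpen_top _⟩ ⟨U, hU⟩
      le_top
  letI : Algebra k A := φ.toAlgebra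
  haveI : Algebra.FiniteType k A := hφ
  haveI : IsNoetherianRing A := Algebra.FiniteType.isNoetherianRing k A
  haveI : IsFractionRing A X.functionField := functionField_isFractionRing_of_isAffineOpen X U hU
  -- `C₀` = the integral closure of `A` in `K(X)`: finite, birational, normal
  set C₀ : Type u := ↥(integralClosure A X.functionField) with hC₀
  haveI : Module.Finite A C₀ := NoetherFiniteIntegralClosure_holds.self k A X.functionField
  haveI : IsFractionRing C₀ X.functionField :=
    integralClosure.isFractionRing_of_finite_extension X.functionField X.functionField
  haveI : IsIntegrallyClosed C₀ :=
    (isIntegrallyClosed_iff_isIntegrallyClosedIn X.functionField).mpr inferInstance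
  letI : Algebra k C₀ := ((algebraMap A C₀).comp (algebraMap k A)).toAlgebra
  haveI : IsScalarTower k A C₀ := IsScalarTower.of_algebraMap_eq fun _ => rfl
  haveI : Algebra.FiniteType k C₀ := Algebra.FiniteType.trans ‹Algebra.FiniteType k A› inferInstance
  have hinj : Function.Injective (algebraMap A C₀) := fun a b hab =>
    IsFractionRing.injective A X.functionField (congrArg Subtype.val hab)
  have hbir : ∀ c : C₀, ∃ s : A, s ≠ 0 ∧ ∃ a : A, s • c = algebraMap A C₀ a := by
    intro c
    obtain ⟨a, s, hs, hc⟩ := IsFractionRing.div_surjective (A := A) c.1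
    refine ⟨s, nonZeroDivisors.ne_zero hs, a, Subtype.ext ?_⟩
    have hsK : algebraMap A X.functionField s ≠ 0 :=
      IsFractionRing.to_map_ne_zero_of_mem_nonZeroDivisors hs
    rw [Subalgebra.coe_smul, ← hc, Algebra.smul_def, mul_div_cancel₀ _ hsK]
    rfl
  have hdom : ∀ (Q : Ideal C₀) [Q.IsMaximal],
      IsDomain (AdicCompletion (maximalIdeal (Localization.AtPrime Q)) (Localization.AtPrime Q)) := by
    intro Q _
    haveI : IsIntegrallyClosed (Localization.AtPrime Q) :=
      isIntegrallyClosed_of_isLocalization Q.primeCompl Q.primeCompl_le_nonZeroDivisors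
        (S := Localization.AtPrime Q)
    exact (isDomain_and_isIntegrallyClosed_adicCompletion_localization_atPrime k Q).1
  -- the maximal ideal `𝔭` of `x = π y` in `A`, and the branch hypothesis at `x`
  set 𝔭 := hU.primeIdealOf ⟨π y, hxU⟩ with h𝔭
  haveI h𝔭max : 𝔭.asIdeal.IsMaximal := hU.primeIdealOf_isMaximal_of_isClosed ⟨π y, hxU⟩ hx
  letI := X.presheaf.algebra_section_stalk (⟨π y, hxU⟩ : ↥U)
  haveI := hU.isLocalization_stalk ⟨π y, hxU⟩
  have hreg := branches_regular_of_ringEquiv (IsLocalization.algEquiv 𝔭.asIdeal.primeCompl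
    (X.presheaf.stalk ((⟨π y, hxU⟩ : ↥U) : ↥X)) (Localization.AtPrime 𝔭.asIdeal)).toRingEquiv
    (h (π y) hx)
  -- `B = Γ(X^ν, π⁻¹ U) ≅ C₀` compatibly with `A → B`
  letI := ((fromSpecFunctionField X).app U).hom.toAlgebra
  let e := functionFieldAlgEquivSections (X := X) U
  let e₁ : C₀ ≃ₐ[A] integralClosure A Γ(Spec X.functionField, fromSpecFunctionField X ⁻¹ᵁ U) :=
    ((integralClosure A X.functionField).equivMapOfInjective e.toAlgHom e.injective).trans
      (Subalgebra.equivOfEq _ _ (integralClosure_map_algEquiv e))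
  let e₂ := ((fromSpecFunctionField X).normalizationObjIso hU).commRingCatIsoToRingEquiv
  let ε : C₀ ≃+* Γ(normalization X, π ⁻¹ᵁ U) := e₁.toRingEquiv.trans e₂.symm
  have hε : ∀ a : A, ε (algebraMap A C₀ a) = (π.app U).hom a := by
    intro a
    have happ := (fromSpecFunctionField X).fromNormalization_app hU
    change _ = ((fromSpecFunctionField X).fromNormalization.app U).hom a
    rw [happ]
    change e₂.symm (e₁ (algebraMap A C₀ a)) = e₂.symm (algebraMap A _ a)
    rw [AlgEquiv.commutes]
  -- the maximal ideal `Q` of `C₀` corresponding to `y`, over `𝔭`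
  set Q : Ideal C₀ := 𝔔.asIdeal.comap ε with hQ
  haveI : Q.IsMaximal := Ideal.comap_isMaximal_of_surjective ε ε.surjective
  have hQ' : Q = 𝔔.asIdeal.comap (ε : C₀ →+* Γ(normalization X, π ⁻¹ᵁ U)) :=
    Ideal.ext fun _ => Iff.rfl
  have hQ𝔭 : Q.comap (algebraMap A C₀) = 𝔭.asIdeal := by
    have h1 : (ε : C₀ →+* Γ(normalization X, π ⁻¹ᵁ U)).comp (algebraMap A C₀) = (π.app U).hom :=
      RingHom.ext hε
    rw [hQ', Ideal.comap_comap, h1, h𝔭, Scheme.Hom.app_eq_appLE]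
    have h2 := congrArg PrimeSpectrum.asIdeal
      (IsAffineOpen.comap_primeIdealOf_appLE U hU (π ⁻¹ᵁ U) hV le_rfl hyV)
    rwa [PrimeSpectrum.comap_asIdeal] at h2
  have hcore := isRegularLocalRing_atPrime_of_branches_regular hinj hbir hdom 𝔭.asIdeal hreg Q hQ𝔭
  -- `(C₀)_Q ≅ B_𝔔`
  haveI := hcore
  exact IsRegularLocalRing.of_ringEquiv (IsLocalization.ringEquivOfRingEquiv
    (Localization.AtPrime Q) (Localization.AtPrime 𝔔.asIdeal) ε (ε.map_primeCompl_comap_eq 𝔔.asIdeal))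

/-- **Regular analytic branches ⇒ resolution by normalisation**: an integral scheme of finite
type over a field all of whose analytic branches at closed points are regular local rings has a
resolution of singularities, namely its (finite, birational) normalisation. [folklore] -/
theorem hasResolution_of_branches_regular {k : Type u} [Field k] (X : Scheme.{u})
    [IsIntegral X] (f : X ⟶ Spec (.of k)) [LocallyOfFiniteType f] [QuasiCompact f]
    (h : ∀ x : X, IsClosed ({x} : Set X) →
      ∀ P ∈ minimalPrimes (AdicCompletion (maximalIdeal (X.presheaf.stalk x)) (X.presheaf.stalk x)),
        IsRegularLocalRing
          (AdicCompletion (maximalIdeal (X.presheaf.stalk x)) (X.presheaf.stalk x) ⧸ P)) :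
    Scheme.HasResolution X :=
  Scheme.HasResolution.of_normalization X f
    (Scheme.IsRegular.hasResolution (isRegular_normalization_of_branches_regular X f h))

/-- **The regular-branch case of the crux `TeissierResolve`.** A Teissier-presented scheme `X'`
(the predicate `TF` of route `TeissierJung`, `TeissierPresented`) all of whose analytic branches at
closed points are regular local rings — e.g. presented with `g = 0` equations everywhere — has a
resolution of singularities: `X'` is integral and finite over a `k`-scheme of finite type, hence of
finite type over `k`, and `hasResolution_of_branches_regular` applies. [folklore] -/
theorem teissierPresented_hasResolution_of_branches_regular {k : Type u} [Field k]
    (X' : Scheme.{u}) (hX' : TeissierPresented k X')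
    (h : ∀ x : X', IsClosed ({x} : Set X') →
      ∀ P ∈ minimalPrimes (AdicCompletion (maximalIdeal (X'.presheaf.stalk x)) (X'.presheaf.stalk x)),
        IsRegularLocalRing
          (AdicCompletion (maximalIdeal (X'.presheaf.stalk x)) (X'.presheaf.stalk x) ⧸ P)) :
    Scheme.HasResolution X' := by
  obtain ⟨S, g, π, hsep, hlft, hqc, -, -, hint, hfin, -⟩ := hX'
  haveI := hsep; haveI := hlft; haveI := hqc; haveI := hint; haveI := hfin
  exact hasResolution_of_branches_regular X' (π ≫ g) h

/-- The same, with the quantifier prefix of the crux: `TeissierResolve` HOLDS on the sub-class of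
Teissier-presented schemes whose branches are all regular (the `g = 0` presentations).
[folklore] -/
theorem teissierResolve_of_branches_regular :
    ∀ p : ℕ, p.Prime → ∀ (k : Type) [Field k] [CharP k p] [IsAlgClosed k] (X' : Scheme.{0}),
      TeissierPresented k X' →
      (∀ x : X', IsClosed ({x} : Set X') →
        ∀ P ∈ minimalPrimes
            (AdicCompletion (maximalIdeal (X'.presheaf.stalk x)) (X'.presheaf.stalk x)),
          IsRegularLocalRing
            (AdicCompletion (maximalIdeal (X'.presheaf.stalk x)) (X'.presheaf.stalk x) ⧸ P)) →
      Scheme.HasResolution X' :=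
  fun _ _ _ _ _ _ X' hX' h => teissierPresented_hasResolution_of_branches_regular X' hX' h

end Schemes

end Summit.ResolutionOfSingularities.ResolutionOfSingularities.Theorems.TeissierResolve.RegularBranches

end
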